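import Summits.BirchSwinnertonDyer.BirchSwinnertonDyer.Theorems.PotSupersingularRungNodes
import Summits.BirchSwinnertonDyer.Rank1Residual.Additive.LocalTorsionExponent
import Summits.BirchSwinnertonDyer.Rank1Residual.Additive.KodairaDictionaryThree
import Summits.BirchSwinnertonDyer.Rank1Residual.Additive.LocalThreeTorsionIffTamagawaThreeOfIVHolds
import Summits.BirchSwinnertonDyer.Rank1Residual.Additive.X4RankZeroKatoBoundTamagawaExact
import Summits.BirchSwinnertonDyer.Rank1Residual.X2.IsogenyClassStability
import Literature.NumberTheory.EllipticCurves.MazurTorsionOrderValuationProofs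
import Literature.NumberTheory.EllipticCurves.PastenValuationProductThm115Proofs
import Literature.NumberTheory.EllipticCurves.IsogenyConductorProofs
import Literature.NumberTheory.EllipticCurves.NeronComponentIndexTypeIIIProofs
import Literature.NumberTheory.EllipticCurves.NeronComponentIndexTypeIIIstarProofs
import Literature.NumberTheory.EllipticCurves.NeronComponentIndexTypeI0starProofs
import Literature.NumberTheory.EllipticCurves.NeronComponentIndexTypeInstarProofs
import Literature.NumberTheory.EllipticCurves.TamagawaNeZeroProofs
import Literature.NumberTheory.EllipticCurves.BSDInvariantsProofs
import Literature.NumberTheory.EllipticCurves.GlobalMinimalModelProofs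
import Literature.NumberTheory.EllipticCurves.ComplexMultiplicationBSDTripleProofs
import HarnessLib

/-!
# Route `KatoDescentTamePotSupersingular` (rung K8, sub-rung B4 (t′), cell `bsd-potss`): the reducible-defect
# node's BODY, ROUTE-FREE (imports NO `Theses.*` file) — `ℤ/p²`-member disjunct void (p ≥ 5 unconditional,
# p = 3 granted Ogg–Saito) ⟹ BODY of `TameUpperReducibleDefect` ⟸ Ogg–Saito ∧ odd-parity rows; the term the
# route's `closes` can call after the planned retype of crux 19203 as the parity statement (TARGET R99)
# (a `--supports … --as helper` file; seat `bsd-potss-k8t-c4` g3; nothing booked, BSD not proved by any of this)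

WHY THIS FILE EXISTS. This seat's p436151 (`…TameUpperReducibleTorsionVoid.lean`) proved
`tameUpperReducibleDefect_of_oggSaito_of_oddParity : (Ogg–Saito schema) → (odd-parity rows) →
TameUpperReducibleDefect`, concluding the route decl BY NAME — so that module imports the route file and
`closes` cannot call it once 19203 is retyped (import cycle; the same obstruction the planner recorded for the
Heegner road, TARGET R100a). Here the same composition is stated ROUTE-FREE: §1–§3 are PRIVATE verbatim
copies of p436151 §1–§3 (the gate's dedup rule forbids public restatement; the public originals stay
importable from the route-importing file), and the one PUBLIC theorem
**`upperReducibleDefect_of_oggSaito_of_oddParity`** concludes the BODY of `TameUpperReducibleDefect` from the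
Ogg–Saito schema and the upper half on the reducible (t′) rank-`0` rows with `ord_p #Ш_an` ODD (the planned
parity restatement of 19203). The route decl unfolds to that body definitionally (certified in this seat's
companion route-importing check file). CONDITIONAL (displayed hypotheses); nothing asserted; NO item closed.

References: [SilvermanAEC2009] VII.3 Prop. 3.1, VII.6 Thm. 6.1, Cor. VII.7.2, VIII.8 Cor. 8.3;
[SilvermanATAEC1994] IV.9.4, Cor. IV.9.2(d), Table 4.1, Thm. IV.10.2, IV.11.1, Exercise 4.40.
-/

set_option autoImplicit false
-- the Theorems directory repeats the summit name (sibling precedent `KatoDescentPotSupersingularAssembly.lean`)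
set_option linter.dupNamespace false

noncomputable section

open scoped Classical

namespace Summit.BirchSwinnertonDyer.BirchSwinnertonDyer.Theorems.TameUpperReducibleNodes

open WeierstrassCurve IsDedekindDomain Literature.NumberTheory.EllipticCurves
  Literature.NumberTheory.EllipticCurves.Rank1Residual
  Literature.NumberTheory.EllipticCurves.Rank1Residual.Typed
  Summit.BirchSwinnertonDyer.Rank1Residual
  Summit.BirchSwinnertonDyer.Rank1Residual.Additive
  Summit.BirchSwinnertonDyer.BirchSwinnertonDyer.Theorems

/-! ## §1 `#E(ℚ)_tors ∣ #E(ℚ_p)_tors`; `ord_p #E(ℚ)_tors ≤ 1` at an additive `p ≥ 3` with `p ∤ c_p` -/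

section GlobalToLocal

variable (W : WeierstrassCurve ℚ) [W.IsElliptic] (p : ℕ) [hp : Fact p.Prime]

omit [W.IsElliptic] in
/-- **`#E(ℚ)_tors ∣ #E(ℚ_p)_tors`**: the injection `E(ℚ) ↪ E(ℚ_p)` (Mathlib's `Affine.Point.map`
along `ℚ → ℚ_p`) restricts to an injective homomorphism of torsion subgroups (Lagrange; if
`E(ℚ_p)_tors` were infinite its `Nat.card` is `0` and the divisibility is trivial).
[cite: SilvermanAEC2009, VII.3 Prop. 3.1 (the standard use: `E(ℚ)_tors ↪ E(ℚ_p)`)] -/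
private theorem torsionOrder_dvd_natCard_torsion_padic :
    W.torsionOrder ∣ Nat.card (AddCommGroup.torsion (W.baseChange ℚ_[p]).toAffine.Point) := by
  set ι : W.toAffine.Point →+ (W.baseChange ℚ_[p]).toAffine.Point :=
    WeierstrassCurve.Affine.Point.map (W' := W.toAffine) (S := ℚ) (Algebra.ofId ℚ ℚ_[p]) with hι
  have hinj : Function.Injective ι :=
    WeierstrassCurve.Affine.Point.map_injective (W' := W.toAffine) (f := Algebra.ofId ℚ ℚ_[p])
  set f : AddCommGroup.torsion W.toAffine.Point →+
      AddCommGroup.torsion (W.baseChange ℚ_[p]).toAffine.Point :=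
    (ι.comp (AddCommGroup.torsion W.toAffine.Point).subtype).codRestrict _ (fun x ↦ by
      rw [AddCommGroup.mem_torsion]
      exact ι.isOfFinAddOrder ((AddCommGroup.mem_torsion _).mp x.2)) with hf
  have hfinj : Function.Injective f := by
    intro x y hxy
    apply Subtype.ext
    apply hinj
    simpa [hf] using congrArg Subtype.val hxy
  rw [torsionOrder_eq_natCard_torsion]
  exact AddSubgroup.card_dvd_of_injective f hfinj

variable [W.IsGloballyMinimal]

/-- **`ord_p #E(ℚ)_tors ≤ 1` at an additive `p ≥ 3` with `p ∤ c_p`** (`W` globally minimal):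
`#E(ℚ)_tors ∣ #E(ℚ_p)_tors ∣ c_p · p` (Silverman *AEC* VII.3.1 with VII.6.1 and `#Ẽ_ns(𝔽_p) = p`;
the b2b cell's `LocalLog.card_torsion_dvd_of_hasAdditiveReduction`), and `c_p ≠ 0`
(`localTamagawaNumber_padic_ne_zero_holds`). [cite: SilvermanAEC2009, VII.3 Prop. 3.1 with VII.6.1] -/
private theorem padicValNat_torsionOrder_le_one_of_addv_of_not_dvd (hp3 : 3 ≤ p) (hadd : Addv W p)
    (hcp : ¬ p ∣ (W.baseChange ℚ_[p]).localTamagawaNumber ℤ_[p]) :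
    padicValNat p W.torsionOrder ≤ 1 := by
  haveI : (W.baseChange ℚ_[p]).IsElliptic := by rw [baseChange]; infer_instance
  haveI := Summit.BirchSwinnertonDyer.Rank1Residual.X11b.Three.JetchevKummer.hasAdditiveReduction_baseChange_padic_of_not_good_of_not_mult
    W p hadd.1 hadd.2
  have hc0 : (W.baseChange ℚ_[p]).localTamagawaNumber ℤ_[p] ≠ 0 := fun h ↦ hcp (h ▸ dvd_zero p)
  have hne : (W.baseChange ℚ_[p]).localTamagawaNumber ℤ_[p] * p ≠ 0 := mul_ne_zero hc0 hp.out.ne_zero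
  have hdvd : W.torsionOrder ∣ (W.baseChange ℚ_[p]).localTamagawaNumber ℤ_[p] * p :=
    (torsionOrder_dvd_natCard_torsion_padic W p).trans
      (LocalLog.card_torsion_dvd_of_hasAdditiveReduction (W.baseChange ℚ_[p]) hp3)
  have h1 : p ^ padicValNat p W.torsionOrder ∣ (W.baseChange ℚ_[p]).localTamagawaNumber ℤ_[p] * p :=
    pow_padicValNat_dvd.trans hdvd
  rw [padicValNat_dvd_iff_le hne, padicValNat.mul hc0 hp.out.ne_zero,
    padicValNat.eq_zero_of_not_dvd hcp, padicValNat.self hp.out.one_lt] at h1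
  omega

end GlobalToLocal

/-! ## §2 `p ≥ 5`: no `ℚ`-isogenous curve of an additive row has `p² ∣ #E'(ℚ)_tors` (no Mazur) -/

section FiveLe

variable {W W' : WeierstrassCurve ℚ} [W.IsElliptic] [W'.IsElliptic] {p : ℕ} [hp : Fact p.Prime]

/-- **`c_p ≤ 4` hence `p ∤ c_p` at an additive `p ≥ 5`** (Kodaira–Néron, Silverman *ATAEC*
Cor. IV.9.2(d): the tree's `localTamagawaNumber_padic_le_four`, the minimal model being additive,
not split multiplicative; and `c_p ≠ 0`). [cite: SilvermanATAEC1994, Cor. IV.9.2(d) (PDF p. 340)] -/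
private theorem not_dvd_localTamagawaNumber_padic_of_addv_of_five_le (W : WeierstrassCurve ℚ) [W.IsElliptic]
    (p : ℕ) [hp : Fact p.Prime] (hp5 : 5 ≤ p) (hadd : Addv W p) :
    ¬ p ∣ (W.baseChange ℚ_[p]).localTamagawaNumber ℤ_[p] := by
  haveI : (W.baseChange ℚ_[p]).IsElliptic := by rw [baseChange]; infer_instance
  have hns : ¬ ((W.baseChange ℚ_[p]).minimal ℤ_[p]).HasSplitMultiplicativeReduction ℤ_[p] :=
    fun h ↦ hadd.2 h.toHasMultiplicativeReduction
  have h4 := localTamagawaNumber_padic_le_four p (W.baseChange ℚ_[p]) hns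
  have h0 : (W.baseChange ℚ_[p]).localTamagawaNumber ℤ_[p] ≠ 0 :=
    localTamagawaNumber_padic_ne_zero_holds p (W.baseChange ℚ_[p])
  intro hdvd
  have := Nat.le_of_dvd (Nat.pos_of_ne_zero h0) hdvd
  omega

/-- **`ord_p #E(ℚ)_tors ≤ 1` at an additive `p ≥ 5`**, `W` globally minimal — no Mazur.
[cite: SilvermanAEC2009, VII.3 Prop. 3.1 with VII.6.1] [cite: SilvermanATAEC1994, Cor. IV.9.2(d)] -/
private theorem padicValNat_torsionOrder_le_one_of_addv_of_five_le (W : WeierstrassCurve ℚ) [W.IsElliptic]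
    [W.IsGloballyMinimal] (p : ℕ) [hp : Fact p.Prime] (hp5 : 5 ≤ p) (hadd : Addv W p) :
    padicValNat p W.torsionOrder ≤ 1 :=
  padicValNat_torsionOrder_le_one_of_addv_of_not_dvd W p (by omega) hadd
    (not_dvd_localTamagawaNumber_padic_of_addv_of_five_le W p hp5 hadd)

/-- **No `ℚ`-isogenous curve of an additive row at `p ≥ 5` has `p² ∣ #E'(ℚ)_tors`** — for EVERY
elliptic model `W'` (pass to a globally minimal model `C • W'`, Silverman *AEC* VIII.8.3, same
torsion order; `W ~ C • W'`; additive reduction is a `ℚ`-isogeny invariant, *AEC* VII.7.2 / §C.16).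
UNCONDITIONAL: the `p ≥ 5` half of the crux's torsion disjunct WITHOUT Mazur's theorem.
[cite: SilvermanAEC2009, VII.3 Prop. 3.1, VII.6.1, Cor. VII.7.2, VIII.8 Cor. 8.3] -/
private theorem not_sq_dvd_torsionOrder_of_isIsogenous_of_addv (hp5 : 5 ≤ p) (hadd : Addv W p)
    (h : IsIsogenous W W') : ¬ p ^ 2 ∣ W'.torsionOrder := by
  obtain ⟨C, hC⟩ := hasGlobalMinimalModel_rat_holds W'
  haveI := hC
  have hiso : IsIsogenous W (C • W') := h.smul_right C
  have hadd' : Addv (C • W') p := (Summit.BirchSwinnertonDyer.Rank1Residual.X2.addv_iff_of_isIsogenous (p := p) hiso).mp hadd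
  have hle := padicValNat_torsionOrder_le_one_of_addv_of_five_le (C • W') p hp5 hadd'
  rw [show (C • W').torsionOrder = W'.torsionOrder from torsionOrder_variableChange_holds W' C] at hle
  intro hdvd
  have hpos : W'.torsionOrder ≠ 0 := (W'.torsionOrder_pos_holds).ne'
  have := (padicValNat_dvd_iff_le hpos).mp hdvd
  omega

end FiveLe

/-! ## §3 `p = 3`: tame additive at `3` ⟹ `3 ∤ c₃` ⟹ `9 ∤ #E(ℚ)_tors`; along an isogeny granted Ogg–Saito -/

section Three

variable {W W' : WeierstrassCurve ℚ} [W.IsElliptic] [W'.IsElliptic]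

/-- **`3 ∤ c₃` at a TAME additive `3`** (`f₃ = 2`, i.e. Kodaira `Iₙ*`, `III` or `III*` by the b2b
cell's dictionary `condExpTwo_three_iff_kodairaSymbolAt_tame`): Tate's algorithm gives `c₃ = 2` for
`III`, `III*` and `c₃ ∈ {1, 2, 4}` for `Iₙ*` (the tree's discharged facts
`localTamagawaNumber_eq_two_of_kodairaSymbolAt_eq_III_holds`, `…IIIstar_holds`,
`…Istar_zero_holds`, `…Istar_succ_holds` at `placeOf 3`, read over `ℤ_[3]` by
`localTamagawaNumber_padic_eq_placeOf`).
[cite: SilvermanATAEC1994, IV.9.4 Steps 4, 6, 7, 9 and Table 4.1 (PDF pp. 344–346, 365)] -/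
private theorem not_three_dvd_localTamagawaNumber_padic_of_condExpTwo_three (W : WeierstrassCurve ℚ)
    [W.IsElliptic] [Fact (Nat.Prime 3)] (hadd : Addv W 3) (hf : CondExpTwo W 3) :
    ¬ 3 ∣ (W.baseChange ℚ_[3]).localTamagawaNumber ℤ_[3] := by
  rw [localTamagawaNumber_padic_eq_placeOf W 3]
  rcases (condExpTwo_three_iff_kodairaSymbolAt_tame W hadd).mp hf with hIII | hIIIs | ⟨n, hn⟩
  · rw [localTamagawaNumber_eq_two_of_kodairaSymbolAt_eq_III_holds (placeOf 3) W hIII]; decide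
  · rw [localTamagawaNumber_eq_two_of_kodairaSymbolAt_eq_IIIstar_holds (placeOf 3) W hIIIs]; decide
  · rcases n with _ | n
    · rcases localTamagawaNumber_of_kodairaSymbolAt_eq_Istar_zero_holds (placeOf 3) W hn with h | h | h <;>
        rw [h] <;> decide
    · rcases localTamagawaNumber_of_kodairaSymbolAt_eq_Istar_succ_holds (placeOf 3) W n hn with h | h <;>
        rw [h] <;> decide

/-- **`9 ∤ #E(ℚ)_tors` on a globally minimal curve that is additive and TAME at `3`** (`f₃ = 2`):
`3 ∤ c₃` and §1. [cite: SilvermanAEC2009, VII.3 Prop. 3.1 with VII.6.1]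
[cite: SilvermanATAEC1994, IV.9.4 and Table 4.1 (PDF p. 365)] -/
private theorem not_nine_dvd_torsionOrder_of_condExpTwo_three (W : WeierstrassCurve ℚ) [W.IsElliptic]
    [W.IsGloballyMinimal] [Fact (Nat.Prime 3)] (hadd : Addv W 3) (hf : CondExpTwo W 3) :
    ¬ 3 ^ 2 ∣ W.torsionOrder := by
  have hle := padicValNat_torsionOrder_le_one_of_addv_of_not_dvd W 3 le_rfl hadd
    (not_three_dvd_localTamagawaNumber_padic_of_condExpTwo_three W hadd hf)
  intro hdvd
  have hpos : W.torsionOrder ≠ 0 := (W.torsionOrder_pos_holds).ne'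
  have := (padicValNat_dvd_iff_le hpos).mp hdvd
  omega

/-- **On a (t′) row at `3`, no `ℚ`-isogenous curve has `9 ∣ #E'(ℚ)_tors` — granted Ogg–Saito.**
For `W` additive at `3` of census type (t′) (`SubTprime W 3`: in particular `f₃ = 2`) and
`W ~ W'` over `ℚ`: a globally minimal model `C • W'` is additive at `3` (*AEC* VII.7.2 / §C.16) with
the SAME conductor exponent `f₃ = 2` (Silverman *ATAEC* Exercise 4.40, the tree's
`IsIsogenous.conductorExponent_int_eq_of_forall_tate`, GRANTED the Ogg–Saito comparison
`a_v(V_ℓ E) = f_v(E)` for every curve — the named fact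
`artinConductorExponent_tate_eq_conductorExponent_of_isElliptic`, binder `hOS`), hence tame, hence
`9 ∤ #(C • W')(ℚ)_tors = #W'(ℚ)_tors`. CONDITIONAL on `hOS`; nothing about it is asserted.
[cite: SilvermanATAEC1994, Exercise 4.40 (PDF p. 380), Thm. IV.10.2 and IV.11.1 (PDF p. 365)]
[cite: SilvermanAEC2009, VII.3 Prop. 3.1, Cor. VII.7.2, VIII.8 Cor. 8.3] -/
private theorem not_nine_dvd_torsionOrder_of_isIsogenous_of_subTprime_three [W.IsGloballyMinimal]
    [Fact (Nat.Prime 3)]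
    (hOS : ∀ (V : WeierstrassCurve ℚ) (ℓ : ℕ) [Fact ℓ.Prime],
      V.artinConductorExponent_tate_eq_conductorExponent_of_isElliptic ℓ)
    (hadd : Addv W 3) (hT : SubTprime W 3) (h : IsIsogenous W W') : ¬ 3 ^ 2 ∣ W'.torsionOrder := by
  obtain ⟨C, hC⟩ := hasGlobalMinimalModel_rat_holds W'
  haveI := hC
  have hiso : IsIsogenous W (C • W') := h.smul_right C
  have hadd' : Addv (C • W') 3 := (Summit.BirchSwinnertonDyer.Rank1Residual.X2.addv_iff_of_isIsogenous (p := 3) hiso).mp hadd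
  have hf : CondExpTwo W 3 := hT.2.1
  have hf' : CondExpTwo (C • W') 3 := by
    unfold CondExpTwo condExp at hf ⊢
    rw [← hiso.conductorExponent_int_eq_of_forall_tate (hOS W) (hOS (C • W')) (placeOf 3)]
    exact hf
  have h9 := not_nine_dvd_torsionOrder_of_condExpTwo_three (C • W') hadd' hf'
  rwa [show (C • W').torsionOrder = W'.torsionOrder from torsionOrder_variableChange_holds W' C] at h9

end Three


/-! ## §4 The reducible-defect node's BODY from Ogg–Saito and the odd-parity rows -/

/-- An odd prime other than `3` is at least `5`. [folklore] -/
private theorem five_le_of_prime_of_ne_two_of_ne_three {p : ℕ} (hp : p.Prime) (h2 : p ≠ 2)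
    (h3 : p ≠ 3) : 5 ≤ p := by
  rcases Nat.lt_or_ge p 5 with h | h
  · have h2le := hp.two_le
    interval_cases p
    · exact absurd rfl h2
    · exact absurd rfl h3
    · exact absurd hp (by decide)
  · exact h

/-- **The BODY of the reducible-defect node `TameUpperReducibleDefect` (item 19203) from the Ogg–Saito
schema and the ODD-PARITY rows** — route-free twin of p436151's
`tameUpperReducibleDefect_of_oggSaito_of_oddParity`: on a reducible (t′) rank-`0` row the `ℤ/p²`-member
disjunct is void (`p ≥ 5`: local torsion at the additive prime, unconditionally; `p = 3`: `f₃` is a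
`ℚ`-isogeny invariant granted Ogg–Saito, so the isogenous curve is tame at `3` and `9 ∤ #E'(ℚ)_tors`), hence
the node follows from the upper half on the rows with `ord_p #Ш_an` ODD (the planned parity restatement of
19203, TARGET R99). The term the route's `closes` calls after the retype (the route decl unfolds to this
body). Conditional on `hOS`, `hodd`; nothing asserted; NO item is closed.
[cite: SilvermanATAEC1994, Exercise 4.40 (PDF p. 380), Thm. IV.10.2, IV.11.1]
[cite: SilvermanAEC2009, VII.3 Prop. 3.1, VII.6.1, Cor. VII.7.2, VIII.8 Cor. 8.3] -/
theorem upperReducibleDefect_of_oggSaito_of_oddParity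
    (hOS : ∀ (V : WeierstrassCurve ℚ) (ℓ : ℕ) [Fact ℓ.Prime],
      V.artinConductorExponent_tate_eq_conductorExponent_of_isElliptic ℓ)
    (hodd : ∀ (W : WeierstrassCurve ℚ) [W.IsElliptic] [W.IsGloballyMinimal] (p : ℕ) [Fact p.Prime],
      W.analyticRank = 0 → p ≠ 2 → Addv W p → SubTprime W p → ¬ W.HasIrreducibleModPGaloisRep p →
      (∃ q : ℚ, shaAn W = (q : ℂ) ∧ ¬ Even (padicValRat p q)) → MissingUpperBoundAt W p) :
    ∀ (W : WeierstrassCurve ℚ) [W.IsElliptic] [W.IsGloballyMinimal] (p : ℕ) [Fact p.Prime],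
      W.analyticRank = 0 → p ≠ 2 → Addv W p → SubTprime W p → ¬ W.HasIrreducibleModPGaloisRep p →
      ¬ ((∀ (W' : WeierstrassCurve ℚ) [W'.IsElliptic], WeierstrassCurve.IsIsogenous W W' →
          ¬ p ^ 2 ∣ W'.torsionOrder) ∧
        ∀ q : ℚ, shaAn W = (q : ℂ) → Even (padicValRat p q)) →
      MissingUpperBoundAt W p := by
  intro W _ _ p _ hr hp2 hadd hT hred hdef
  by_cases hpar : ∀ q : ℚ, shaAn W = (q : ℂ) → Even (padicValRat p q)
  · -- the parity clause holds, so the torsion clause fails: some isogenous `W'` has `p² ∣ #W'(ℚ)_tors`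
    have htor : ¬ ∀ (W' : WeierstrassCurve ℚ) [W'.IsElliptic],
        IsIsogenous W W' → ¬ p ^ 2 ∣ W'.torsionOrder := fun h ↦ hdef ⟨h, hpar⟩
    push Not at htor
    obtain ⟨W', hW', hiso, hdvd⟩ := htor
    by_cases h3 : p = 3
    · subst h3
      exact absurd hdvd (not_nine_dvd_torsionOrder_of_isIsogenous_of_subTprime_three hOS hadd hT hiso)
    · exact absurd hdvd (not_sq_dvd_torsionOrder_of_isIsogenous_of_addv
        (five_le_of_prime_of_ne_two_of_ne_three Fact.out hp2 h3) hadd hiso)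
  · push Not at hpar
    obtain ⟨q, hq, hodd'⟩ := hpar
    exact hodd W p hr hp2 hadd hT hred ⟨q, hq, hodd'⟩

end Summit.BirchSwinnertonDyer.BirchSwinnertonDyer.Theorems.TameUpperReducibleNodes

end
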